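import Summits.Ventures.LatticeQCDFlow.Exactness.IMHCoupledEstimatorCLT
import HarnessLib

/-!
# A finite-`R` exponential error bar for the coupled flow-MCMC estimator (Hoeffding):
# `P(|H̄_R − π f| ≥ ε + (1 − A)^{k+N}(c − a)) ≤ 2·exp(−2Rε²/((2N + 1)(c − a))²)` for `R` independent coupled pairs

HONEST FRAMING: exact (Metropolis-corrected) sampling algorithms for lattice gauge theory;
figures of merit are autocorrelation/cost numbers at stated couplings and volumes; no
continuum-physics claim.

Venture `LatticeQCDFlow` (cell pub-lqcd), topic `Exactness`; FANOUT row 30 (lean-1, GEN-39).  NEW WORK of the cell;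
sequel to GEN-37/38's replica files (`Exactness/IMHCoupledEstimatorReplicas`, `…ErrorBar`, `…CLT`: for mutually independent
pair streams `Z_0, Z_1, …` from ONE initial coupling one update ahead, the truncated coupled estimates
`H_j = H_{k,N}(Z_j) = f(Y_k) + Σ_{n<N} D_{k+n}`, `a ≤ f ≤ c`, have the common exact mean `m_{k,N} = (ν₂K^{k+N}) f` with
`|m_{k,N} − π f| ≤ r^{k+N}(c − a)`, Chebyshev bars and a CLT; «NOT CLAIMED: any finite-`R` coverage statement beyond Chebyshev»).
Here a DISTRIBUTION-FREE EXPONENTIAL bar at every finite `R`, from the range bound `H_{k,N} ∈ [a − N(c − a), c + N(c − a)]` and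
Mathlib's Hoeffding inequality (`hasSubgaussianMGF_of_mem_Icc`, `measure_sum_range_ge_le_of_iIndepFun`) APPLIED:

* §1 (generic, [ours]) **`hoeffding_avg_ge_of_mem_Icc`**, **`hoeffding_avg_le_of_mem_Icc`**, **`hoeffding_avg_abs_of_mem_Icc`** —
  for mutually independent measurable `X_j ∈ [a, b]` with a common mean `m`: `P(±(R⁻¹Σ_{j<R} X_j − m) ≥ ε) ≤ exp(−2Rε²/(b − a)²)` and
  the two-sided `2·exp(…)` (`ε ≥ 0`, `R ≥ 1`); **`hoeffding_exponent_eq`**, **`crnLagEstimator_mem_Icc`** [bookkeeping].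
* §2 **`crnLag_replicas_hoeffding_abs`** — `P(|R⁻¹Σ_{j<R} H_{k,N}(Z_j) − m_{k,N}| ≥ ε) ≤ 2·exp(−2Rε²/((2N + 1)(c − a))²)`.
* §3 **`crnLag_replicas_hoeffding_abs_target`** — ABOUT `π f` ITSELF (`w` maximal at `x₀`, `r = 1 − 1/w(x₀)`):
  `P(|H̄_R − π f| ≥ ε + r^{k+N}(c − a)) ≤ 2·exp(−2Rε²/((2N + 1)(c − a))²)` — a certified, non-asymptotic confidence statement for
  the printed average of `R` coupled estimates: exponential in `R`, no variance, autocorrelation time or reference value needed.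
Reading (gauge files): the average of `R` independent burn-in-`k`, window-`N` coupled estimates of two exact gauge samplers misses the
exact expectation value by `ε + (1 − A)^{k+N}(c − a)` or more with probability at most `2·exp(−2Rε²/((2N + 1)(c − a))²)`.
NOT CLAIMED: a variance-sensitive (Bernstein) exponent — the range `(2N + 1)(c − a)` is crude when corrections are rare (the sequel
`…BurnInHoeffding` recovers the equilibrium range `c − a` at the price `R·r^k`); the untruncated estimator (unbounded);
anything for unbounded `f` or any value of `A`.  No `sorry`, no new definitions, nothing cited as a fact.
-/

noncomputable section

namespace Summit.Ventures.LatticeQCDFlow.Exactness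

open MeasureTheory ProbabilityTheory Function Finset Filter
open scoped ENNReal unitInterval Topology NNReal
open Summit.Ventures.LatticeQCDFlow.Scoring

variable {Ω : Type*} [MeasurableSpace Ω] {q : Measure Ω} [IsProbabilityMeasure q] {w : Ω → ℝ}

/-! ## §1 Hoeffding's inequality for the average of bounded independent variables with a common mean (generic) -/

/-- The Hoeffding exponent for `R ≥ 1` summands of range `b − a`: `−(Rε)²/(2R·((b − a)/2)²) = −2Rε²/(b − a)²`. [ours, bookkeeping] -/
theorem hoeffding_exponent_eq {a b ε : ℝ} {R : ℕ} (hR : 1 ≤ R) :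
    -((R : ℝ) * ε) ^ 2 / (2 * R * ((b - a) / 2) ^ 2) = -(2 * R * ε ^ 2) / (b - a) ^ 2 := by
  have hR0 : (R : ℝ) ≠ 0 := Nat.cast_ne_zero.2 (by omega)
  rcases eq_or_ne (b - a) 0 with hba | hba
  · simp [hba]
  · field_simp

section Generic

variable {Ω' : Type*} {mΩ' : MeasurableSpace Ω'} {μ : Measure Ω'} [IsProbabilityMeasure μ] {X : ℕ → Ω' → ℝ}

/-- **HOEFFDING, UPPER TAIL, FOR AN AVERAGE**: mutually independent measurable `X_j ∈ [a, b]` with a common mean `m`; for `ε ≥ 0` and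
`R ≥ 1`, `P(R⁻¹Σ_{j<R} X_j − m ≥ ε) ≤ exp(−2Rε²/(b − a)²)`. [ours — Mathlib's Hoeffding inequality applied] -/
theorem hoeffding_avg_ge_of_mem_Icc (hXm : ∀ j, Measurable (X j)) (hind : iIndepFun X μ) {a b : ℝ}
    (hbd : ∀ j ω, X j ω ∈ Set.Icc a b) {m : ℝ} (hmean : ∀ j, μ[X j] = m) {ε : ℝ} (hε : 0 ≤ ε) {R : ℕ} (hR : 1 ≤ R) :
    μ.real {ω | ε ≤ (R : ℝ)⁻¹ * ∑ j ∈ range R, X j ω - m} ≤ Real.exp (-(2 * R * ε ^ 2) / (b - a) ^ 2) := by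
  have hsubG : ∀ j, HasSubgaussianMGF (fun ω => X j ω - m) ((‖b - a‖₊ / 2) ^ 2) μ := by
    intro j
    rw [← hmean j]
    exact hasSubgaussianMGF_of_mem_Icc (hXm j).aemeasurable (ae_of_all _ fun ω => hbd j ω)
  have hind' : iIndepFun (fun j ω => X j ω - m) μ := hind.comp (fun _ => fun x : ℝ => x - m) fun _ => measurable_id.sub_const m
  have hRpos : (0 : ℝ) < R := Nat.cast_pos.2 (by omega)
  have hR0 : (R : ℝ) ≠ 0 := hRpos.ne'
  have h := HasSubgaussianMGF.measure_sum_range_ge_le_of_iIndepFun hind' (n := R) (fun j _ => hsubG j)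
    (ε := R * ε) (mul_nonneg hRpos.le hε)
  have hset : {ω | ε ≤ (R : ℝ)⁻¹ * ∑ j ∈ range R, X j ω - m} = {ω | (R : ℝ) * ε ≤ ∑ j ∈ range R, (X j ω - m)} := by
    ext ω
    simp only [Set.mem_setOf_eq, sum_sub_distrib, sum_const, card_range, nsmul_eq_mul]
    constructor
    · intro h0
      have h1 := mul_le_mul_of_nonneg_left h0 hRpos.le
      rwa [mul_sub, ← mul_assoc, mul_inv_cancel₀ hR0, one_mul] at h1
    · intro h0
      have h1 := mul_le_mul_of_nonneg_left h0 (inv_nonneg.2 hRpos.le)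
      rwa [mul_sub, ← mul_assoc, inv_mul_cancel₀ hR0, one_mul, ← mul_assoc, inv_mul_cancel₀ hR0, one_mul] at h1
  have hexp : -((R : ℝ) * ε) ^ 2 / (2 * R * (((‖b - a‖₊ / 2) ^ 2 : ℝ≥0) : ℝ)) = -(2 * R * ε ^ 2) / (b - a) ^ 2 := by
    rw [NNReal.coe_pow, NNReal.coe_div, coe_nnnorm, Real.norm_eq_abs, NNReal.coe_ofNat, div_pow, sq_abs, ← div_pow]
    exact hoeffding_exponent_eq hR
  rw [hset, ← hexp]
  exact h

/-- **HOEFFDING, LOWER TAIL, FOR AN AVERAGE**: `P(m − R⁻¹Σ_{j<R} X_j ≥ ε) ≤ exp(−2Rε²/(b − a)²)`. [ours — Mathlib's Hoeffding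
inequality applied] -/
theorem hoeffding_avg_le_of_mem_Icc (hXm : ∀ j, Measurable (X j)) (hind : iIndepFun X μ) {a b : ℝ}
    (hbd : ∀ j ω, X j ω ∈ Set.Icc a b) {m : ℝ} (hmean : ∀ j, μ[X j] = m) {ε : ℝ} (hε : 0 ≤ ε) {R : ℕ} (hR : 1 ≤ R) :
    μ.real {ω | ε ≤ m - (R : ℝ)⁻¹ * ∑ j ∈ range R, X j ω} ≤ Real.exp (-(2 * R * ε ^ 2) / (b - a) ^ 2) := by
  -- apply the upper tail to `−X_j ∈ [−b, −a]` with mean `−m`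
  have h := hoeffding_avg_ge_of_mem_Icc (X := fun j ω => -X j ω) (fun j => (hXm j).neg)
    (hind.comp (fun _ => fun x : ℝ => -x) fun _ => measurable_neg) (a := -b) (b := -a)
    (fun j ω => ⟨neg_le_neg (hbd j ω).2, neg_le_neg (hbd j ω).1⟩) (m := -m)
    (fun j => by rw [integral_neg, hmean j]) hε hR
  have hset : {ω | ε ≤ m - (R : ℝ)⁻¹ * ∑ j ∈ range R, X j ω} = {ω | ε ≤ (R : ℝ)⁻¹ * ∑ j ∈ range R, -X j ω - -m} := by
    ext ω
    simp only [Set.mem_setOf_eq, sum_neg_distrib, mul_neg, sub_neg_eq_add]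
    rw [neg_add_eq_sub]
  have hba : (-a - -b) ^ 2 = (b - a) ^ 2 := by ring
  rw [hset, ← hba]
  exact h

/-- **HOEFFDING, TWO-SIDED, FOR AN AVERAGE**: `P(|R⁻¹Σ_{j<R} X_j − m| ≥ ε) ≤ 2·exp(−2Rε²/(b − a)²)`. [ours — Mathlib's Hoeffding
inequality applied] -/
theorem hoeffding_avg_abs_of_mem_Icc (hXm : ∀ j, Measurable (X j)) (hind : iIndepFun X μ) {a b : ℝ}
    (hbd : ∀ j ω, X j ω ∈ Set.Icc a b) {m : ℝ} (hmean : ∀ j, μ[X j] = m) {ε : ℝ} (hε : 0 ≤ ε) {R : ℕ} (hR : 1 ≤ R) :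
    μ.real {ω | ε ≤ |(R : ℝ)⁻¹ * ∑ j ∈ range R, X j ω - m|} ≤ 2 * Real.exp (-(2 * R * ε ^ 2) / (b - a) ^ 2) := by
  have h1 := hoeffding_avg_ge_of_mem_Icc hXm hind hbd hmean hε hR
  have h2 := hoeffding_avg_le_of_mem_Icc hXm hind hbd hmean hε hR
  have hsub : {ω | ε ≤ |(R : ℝ)⁻¹ * ∑ j ∈ range R, X j ω - m|} ⊆
      {ω | ε ≤ (R : ℝ)⁻¹ * ∑ j ∈ range R, X j ω - m} ∪ {ω | ε ≤ m - (R : ℝ)⁻¹ * ∑ j ∈ range R, X j ω} := by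
    intro ω hω
    simp only [Set.mem_setOf_eq, Set.mem_union] at hω ⊢
    rcases le_abs'.1 hω with h | h
    · right; linarith
    · left; exact h
  calc μ.real {ω | ε ≤ |(R : ℝ)⁻¹ * ∑ j ∈ range R, X j ω - m|}
      ≤ μ.real ({ω | ε ≤ (R : ℝ)⁻¹ * ∑ j ∈ range R, X j ω - m} ∪ {ω | ε ≤ m - (R : ℝ)⁻¹ * ∑ j ∈ range R, X j ω}) :=
        measureReal_mono hsub
    _ ≤ μ.real {ω | ε ≤ (R : ℝ)⁻¹ * ∑ j ∈ range R, X j ω - m} + μ.real {ω | ε ≤ m - (R : ℝ)⁻¹ * ∑ j ∈ range R, X j ω} :=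
        measureReal_union_le _ _
    _ ≤ 2 * Real.exp (-(2 * R * ε ^ 2) / (b - a) ^ 2) := by linarith

end Generic

omit [MeasurableSpace Ω] in
/-- `H_{k,N}(z) = f((z k).2) + Σ_{n<N}(f((z(k+n)).1) − f((z(k+n)).2)) ∈ [a − N(c − a), c + N(c − a)]` for `a ≤ f ≤ c`. [ours, bookkeeping] -/
theorem crnLagEstimator_mem_Icc {f : Ω → ℝ} {a c : ℝ} (ha : ∀ x, a ≤ f x) (hc : ∀ x, f x ≤ c) (k N : ℕ) (z : ℕ → Ω × Ω) :
    f ((z k).2) + ∑ n ∈ range N, (f ((z (k + n)).1) - f ((z (k + n)).2)) ∈ Set.Icc (a - N * (c - a)) (c + N * (c - a)) := by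
  have hD : ∀ n ∈ range N, |f ((z (k + n)).1) - f ((z (k + n)).2)| ≤ c - a := fun n _ =>
    abs_sub_le_iff.2 ⟨by linarith [hc (z (k + n)).1, ha (z (k + n)).2], by linarith [hc (z (k + n)).2, ha (z (k + n)).1]⟩
  have hS : |∑ n ∈ range N, (f ((z (k + n)).1) - f ((z (k + n)).2))| ≤ N * (c - a) :=
    calc |∑ n ∈ range N, (f ((z (k + n)).1) - f ((z (k + n)).2))|
        ≤ ∑ n ∈ range N, |f ((z (k + n)).1) - f ((z (k + n)).2)| := abs_sum_le_sum_abs _ _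
      _ ≤ ∑ n ∈ range N, (c - a) := sum_le_sum hD
      _ = N * (c - a) := by rw [sum_const, card_range, nsmul_eq_mul]
  rw [abs_le] at hS
  exact ⟨by linarith [ha (z k).2, hS.1], by linarith [hc (z k).2, hS.2]⟩

section Replicas

variable {Ω' : Type*} {mΩ' : MeasurableSpace Ω'} {μ : Measure Ω'} [IsProbabilityMeasure μ]
  {Z : ℕ → Ω' → (ℕ → Ω × Ω)}

/-! ## §2 Hoeffding's inequality for the average of `R` coupled estimates about their exact mean -/

/-- **HOEFFDING FOR COUPLED ESTIMATES, TWO-SIDED**: mutually independent pair streams with the common law of the pair chain from ONE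
initial coupling `ν̂` one update ahead, `a ≤ f ≤ c` measurable, `m_{k,N} = (ν₂K^{k+N}) f`; for `ε ≥ 0` and `R ≥ 1`,
`P(|R⁻¹Σ_{j<R} H_{k,N}(Z_j) − m_{k,N}| ≥ ε) ≤ 2·exp(−2Rε²/((2N + 1)(c − a))²)`. [ours — Mathlib's Hoeffding inequality applied] -/
theorem crnLag_replicas_hoeffding_abs [Fact (Measurable w)] (hw0 : ∀ y, 0 < w y)
    (Khat : Kernel (Ω × Ω) (Ω × Ω)) [IsMarkovKernel Khat]
    (hK : ∀ z : Ω × Ω, Khat z = (q.prod (volume : Measure unitInterval)).map (fun p : Ω × unitInterval =>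
      ((if (p.2 : ℝ) * w z.1 ≤ w p.1 then p.1 else z.1), (if (p.2 : ℝ) * w z.2 ≤ w p.1 then p.1 else z.2))))
    (ν : Measure (Ω × Ω)) [IsProbabilityMeasure ν] (hlag : ν.map Prod.fst = (ν.map Prod.snd).bind (indepMH q w))
    {f : Ω → ℝ} (hf : Measurable f) {a c : ℝ} (ha : ∀ x, a ≤ f x) (hc : ∀ x, f x ≤ c) (k N : ℕ)
    (hZm : ∀ j, Measurable (Z j))
    (hlaw : ∀ j, μ.map (Z j) = Kernel.trajMeasure (X := fun _ : ℕ => Ω × Ω) ν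
      (fun n : ℕ => Khat.comap (fun h : (i : ↥(Finset.Iic n)) → Ω × Ω => h ⟨n, Finset.mem_Iic.2 le_rfl⟩)
        (measurable_pi_apply _)))
    (hind : iIndepFun Z μ) {ε : ℝ} (hε : 0 ≤ ε) {R : ℕ} (hR : 1 ≤ R) :
    μ.real {ω | ε ≤ |(R : ℝ)⁻¹ * ∑ j ∈ range R, (f ((Z j ω k).2) + ∑ n ∈ range N, (f ((Z j ω (k + n)).1) - f ((Z j ω (k + n)).2))) -
        ∫ y, f y ∂((fun m : Measure Ω => m.bind (indepMH q w))^[k + N] (ν.map Prod.snd))|} ≤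
      2 * Real.exp (-(2 * R * ε ^ 2) / ((2 * N + 1) * (c - a)) ^ 2) := by
  have hHm : Measurable fun z : ℕ → Ω × Ω => f ((z k).2) + ∑ n ∈ range N, (f ((z (k + n)).1) - f ((z (k + n)).2)) :=
    measurable_crnLagEstimator hf k N
  have hC : ∀ x, |f x| ≤ max |a| |c| := fun x => abs_le_max_abs_abs (ha x) (hc x)
  have hmean : ∀ j, μ[fun ω => f ((Z j ω k).2) + ∑ n ∈ range N, (f ((Z j ω (k + n)).1) - f ((Z j ω (k + n)).2))] =
      ∫ y, f y ∂((fun m : Measure Ω => m.bind (indepMH q w))^[k + N] (ν.map Prod.snd)) := fun j => by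
    rw [integral_comp_eq_of_map_eq (hZm j) (hlaw j) hHm]
    exact crnLag_truncated_integral_eq hw0 Khat hK ν hlag hf hC k N
  have h := hoeffding_avg_abs_of_mem_Icc (μ := μ)
    (X := fun j ω => f ((Z j ω k).2) + ∑ n ∈ range N, (f ((Z j ω (k + n)).1) - f ((Z j ω (k + n)).2)))
    (fun j => hHm.comp (hZm j)) (hind.comp (fun _ => _) fun _ => hHm)
    (fun j ω => crnLagEstimator_mem_Icc ha hc k N (Z j ω)) hmean hε hR
  have hw' : (c + N * (c - a) - (a - N * (c - a))) ^ 2 = ((2 * N + 1) * (c - a)) ^ 2 := by ring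
  rw [hw'] at h
  exact h

/-! ## §3 About the target `π f` itself -/

/-- **A CERTIFIED NON-ASYMPTOTIC CONFIDENCE STATEMENT ABOUT `π f`**: `w` maximal at `x₀`, `r = 1 − 1/w(x₀)`; for `ε ≥ 0` and `R ≥ 1`,
`P(|R⁻¹Σ_{j<R} H_{k,N}(Z_j) − π f| ≥ ε + r^{k+N}(c − a)) ≤ 2·exp(−2Rε²/((2N + 1)(c − a))²)`. [ours] -/
theorem crnLag_replicas_hoeffding_abs_target [Fact (Measurable w)] (hw0 : ∀ y, 0 < w y) {x₀ : Ω} (hmax : ∀ y, w y ≤ w x₀)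
    [IsProbabilityMeasure (q.withDensity fun y => ENNReal.ofReal (w y))]
    (Khat : Kernel (Ω × Ω) (Ω × Ω)) [IsMarkovKernel Khat]
    (hK : ∀ z : Ω × Ω, Khat z = (q.prod (volume : Measure unitInterval)).map (fun p : Ω × unitInterval =>
      ((if (p.2 : ℝ) * w z.1 ≤ w p.1 then p.1 else z.1), (if (p.2 : ℝ) * w z.2 ≤ w p.1 then p.1 else z.2))))
    (ν : Measure (Ω × Ω)) [IsProbabilityMeasure ν] (hlag : ν.map Prod.fst = (ν.map Prod.snd).bind (indepMH q w))
    {f : Ω → ℝ} (hf : Measurable f) {a c : ℝ} (ha : ∀ x, a ≤ f x) (hc : ∀ x, f x ≤ c) (k N : ℕ)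
    (hZm : ∀ j, Measurable (Z j))
    (hlaw : ∀ j, μ.map (Z j) = Kernel.trajMeasure (X := fun _ : ℕ => Ω × Ω) ν
      (fun n : ℕ => Khat.comap (fun h : (i : ↥(Finset.Iic n)) → Ω × Ω => h ⟨n, Finset.mem_Iic.2 le_rfl⟩)
        (measurable_pi_apply _)))
    (hind : iIndepFun Z μ) {ε : ℝ} (hε : 0 ≤ ε) {R : ℕ} (hR : 1 ≤ R) :
    μ.real {ω | ε + (1 - (w x₀)⁻¹) ^ (k + N) * (c - a) ≤
        |(R : ℝ)⁻¹ * ∑ j ∈ range R, (f ((Z j ω k).2) + ∑ n ∈ range N, (f ((Z j ω (k + n)).1) - f ((Z j ω (k + n)).2))) -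
          ∫ x, f x ∂(q.withDensity fun y => ENNReal.ofReal (w y))|} ≤
      2 * Real.exp (-(2 * R * ε ^ 2) / ((2 * N + 1) * (c - a)) ^ 2) := by
  set m := ∫ y, f y ∂((fun m : Measure Ω => m.bind (indepMH q w))^[k + N] (ν.map Prod.snd)) with hm
  set πf := ∫ x, f x ∂(q.withDensity fun y => ENNReal.ofReal (w y)) with hπf
  set X : ℕ → Ω' → ℝ := fun j ω => f ((Z j ω k).2) + ∑ n ∈ range N, (f ((Z j ω (k + n)).1) - f ((Z j ω (k + n)).2)) with hX
  have hbias : |m - πf| ≤ (1 - (w x₀)⁻¹) ^ (k + N) * (c - a) := crnLag_replica_mean_sub_abs_le hw0 hmax ν hf ha hc k N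
  have h := crnLag_replicas_hoeffding_abs hw0 Khat hK ν hlag hf ha hc k N hZm hlaw hind hε hR
  have hsub : {ω | ε + (1 - (w x₀)⁻¹) ^ (k + N) * (c - a) ≤ |(R : ℝ)⁻¹ * ∑ j ∈ range R, X j ω - πf|} ⊆
      {ω | ε ≤ |(R : ℝ)⁻¹ * ∑ j ∈ range R, X j ω - m|} := by
    intro ω hω
    simp only [Set.mem_setOf_eq] at hω ⊢
    have htri : |(R : ℝ)⁻¹ * ∑ j ∈ range R, X j ω - πf| ≤ |(R : ℝ)⁻¹ * ∑ j ∈ range R, X j ω - m| + |m - πf| :=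
      abs_sub_le ((R : ℝ)⁻¹ * ∑ j ∈ range R, X j ω) m πf
    linarith
  show μ.real {ω | ε + (1 - (w x₀)⁻¹) ^ (k + N) * (c - a) ≤ |(R : ℝ)⁻¹ * ∑ j ∈ range R, X j ω - πf|} ≤ _
  exact (measureReal_mono hsub).trans h

end Replicas

end Summit.Ventures.LatticeQCDFlow.Exactness

end
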